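import Mathlib.Topology.Algebra.OpenSubgroup
import Literature.AnabelianGeometry.SemiGraphs.TemperedReconstructionCor39Finite
import Literature.AnabelianGeometry.SemiGraphs.TemperedReconstructionCor39UpToTwist
import Literature.AnabelianGeometry.SemiGraphs.TemperedReconstructionR2bHomProofs
import Literature.AnabelianGeometry.SemiGraphs.TemperedMaximalCompactFiniteAt
import Literature.AnabelianGeometry.SemiGraphs.TemperedReconstructionReductions
import HarnessLib

/-!
# [SemiAnbd] Cor. 3.9 AS LITERALLY TYPED (`ProfiniteSemiGraph.Cor39`): reduction of its refutation to a
# "fold" witness (row O-Cor39-1 of the abc-iut cell, part 1)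

Mochizuki, *Semi-graphs of anabelioids*, Publ. RIMS **42** (2006), §3, Cor. 3.9 p. 42 and Def. 3.8
p. 42 [cite: MochizukiSemiAnbd2006, Cor 3.9 p.42].

The frozen named fact `ProfiniteSemiGraph.Cor39` (`TemperedReconstruction.lean`, abc-iut-L3-t2/L3-d4)
renders Cor. 3.9 with (1) the LITERAL reading `IsQuasiGeometric` of Def. 3.8 (the "respectively" clause
read independently: a nontrivial intersection of two distinct maximal compact subgroups goes onto an open
subgroup of SOME nontrivial intersection of two distinct maximal compact subgroups — finding t2g2-F1: this
admits "fold" homomorphisms, cf. the additive compatible reading `IsCompatiblyQuasiGeometric`), and (2)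
"induced" = `Hom.Induces`, the pull-back glued with the CHOSEN conjugators (`Classical.choose`,
finding d080-F2; additive twins `Hom.InducesWith`/`InducesUpToTwist`, theorem
`cor39UpToTwistAt_of_finite`).  This proof-only file isolates what defect (1) costs, choice-independently:

* `relIndex_ne_zero_of_mapsOntoOpenSubgroupOf` — an open subgroup of a compact subgroup has finite
  relative index;
* `eq_of_mapsOntoOpenSubgroupOf_of_le` — at a FINITE graph, two verticial (= maximal compact, Thm 3.7
  (iv)) subgroups one of which contains an open subgroup of the other coincide (Thm 3.7 (ii));
* `not_isCompatiblyQuasiGeometric_of_range_le` — a literally quasi-geometric `φ` into `π₁^temp(ℋ)`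
  (`ℋ` finite) whose range lies in ONE verticial subgroup, on a source having two distinct maximal compact
  subgroups with nontrivial intersection, is NOT compatibly quasi-geometric (both are sent openly into the
  same maximal compact subgroup);
* **`not_cor39_of_fold`** — if some finite pair `(𝒢, ℋ)` satisfying the hypotheses of Cor. 3.9 carries,
  for some charts, a homomorphism `φ : π₁^temp(𝒢) → π₁^temp(ℋ)` that is quasi-geometric in the literal
  reading but not in the compatible one, then the literal `Cor39` is FALSE: clause (b) would give a locally
  open `F` with `F.Induces φ`, i.e. `F.InducesWith F.chosenConjugators φ` (`induces_iff_inducesWith_chosen`),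
  and clause (a) of `cor39UpToTwistAt_of_finite` makes every homomorphism so induced (for ANY conjugator
  family) compatibly quasi-geometric;
* `not_cor39_of_range_le` — the assembled form: a literally quasi-geometric `φ` with range in a verticial
  subgroup of `π₁^temp(ℋ)` at a finite Cor-3.9 pair whose source has an estranged edge seen by two
  distinct maximal compact subgroups refutes `Cor39`.

The fold witness itself (the "collapse" of the Iwahori loop graph of abc-iut-w5-d236 onto its vertex
group) is the sequel.  Nothing here edits a statement of the tree; no side is taken on [IUTchIII] Cor. 3.12;
the compatible/up-to-twist Cor. 3.9 (`cor39UpToTwistAt_of_finite`, `Cor39CompatUpToTwist`) is untouched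
and remains the form consumers bind.
-/

namespace Literature.AnabelianGeometry.SemiGraphs

namespace ProfiniteSemiGraph

open CategoryTheory Topology

universe u

variable {𝒢 ℋ : ProfiniteSemiGraph.{u}}

/-! ### Open subgroups of compact subgroups have finite relative index -/

/-- If `S ≤ M`, `M` is compact and `S` is open in `M` (subspace topology), then `S` has finite index in
`M` (`S.relIndex M ≠ 0`): `M ⧸ S` is compact and discrete — the finiteness behind "maps surjectively onto an
open subgroup of [a maximal compact subgroup]" in Def. 3.8. [cite: MochizukiSemiAnbd2006, Def 3.8 p.42] -/
theorem relIndex_ne_zero_of_isOpen_preimage {G : Type u} [Group G] [TopologicalSpace G]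
    [IsTopologicalGroup G] {S M : Subgroup G} (hMc : IsCompact (M : Set G))
    (hopen : IsOpen ((Subtype.val : M → G) ⁻¹' (S : Set G))) : S.relIndex M ≠ 0 := by
  haveI : CompactSpace M := isCompact_iff_compactSpace.mp hMc
  have hopen' : IsOpen ((S.subgroupOf M : Subgroup M) : Set M) := by
    rw [Subgroup.coe_subgroupOf]
    exact hopen
  haveI : Finite (M ⧸ S.subgroupOf M) := Subgroup.quotient_finite_of_isOpen _ hopen'
  exact Subgroup.index_ne_zero_of_finite

/-- `MapsOntoOpenSubgroupOf φ K₁ K₂` with `K₂` compact gives `(K₁.map φ).relIndex K₂ ≠ 0`.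
[cite: MochizukiSemiAnbd2006, Def 3.8 p.42] -/
theorem relIndex_ne_zero_of_mapsOntoOpenSubgroupOf {G₁ : Type u} [Group G₁] {G₂ : Type u} [Group G₂]
    [TopologicalSpace G₂] [IsTopologicalGroup G₂] (φ : G₁ →* G₂) {K₁ : Subgroup G₁} {K₂ : Subgroup G₂}
    (hK₂c : IsCompact (K₂ : Set G₂)) (h : MapsOntoOpenSubgroupOf φ K₁ K₂) :
    (K₁.map φ).relIndex K₂ ≠ 0 :=
  relIndex_ne_zero_of_isOpen_preimage hK₂c h.2

/-! ### At a finite graph: verticial subgroups sharing a finite-index piece coincide -/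

/-- At a FINITE graph `ℋ` (Thm 3.7 (ii)+(iv) in tree): if a subgroup `S` of `π₁^temp(ℋ)` is mapped
(by the identity) onto an open subgroup of a maximal compact subgroup `M` — i.e. `S ≤ M` is open in `M` —
and `S ≤ V` for a verticial subgroup `V`, then `M = V` (only the trace `S ∩ M`, open in `M`, is used). [cite: MochizukiSemiAnbd2006, Thm 3.7(ii)(iv) pp.40-41] -/
theorem eq_of_isOpen_of_le [Finite ℋ.graph.Vertex] [Finite ℋ.graph.Edge] (hℋ : ℋ.Thm37Hypotheses)
    (c : TemperedPiChart ℋ) {S M V : Subgroup c.G} (hM : IsMaximalCompactSubgroup M)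
    {v : ℋ.graph.Vertex} (hV : V ∈ verticialSubgroups c v)
    (hopen : IsOpen ((Subtype.val : M → c.G) ⁻¹' (S : Set c.G))) (hSV : S ≤ V) : M = V := by
  -- `M` is verticial at some vertex (Thm 3.7 (iv) at the finite graph)
  obtain ⟨w, hMw⟩ := (isMaximalCompactSubgroup_iff_mem_verticialSubgroups_of_finiteGraph hℋ c M).1 hM
  -- `S` has finite index in `M`, hence so has `V ⊓ M`
  have hS : S.relIndex M ≠ 0 := relIndex_ne_zero_of_isOpen_preimage hM.1 hopen
  have hVM : V.relIndex M ≠ 0 := fun h0 => hS (Subgroup.relIndex_eq_zero_of_le_left hSV h0)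
  exact eq_of_relIndex_ne_zero_of_mem_verticialSubgroups verticialDistinct_holds hℋ c hMw hV hVM

/-- Variant: a maximal compact subgroup `K₂` CONTAINING a subgroup `S` which is open in a maximal compact
`M` with `S ≤ V` verticial equals `V` as well. [cite: MochizukiSemiAnbd2006, Thm 3.7(ii)(iv) pp.40-41] -/
theorem eq_of_le_of_isOpen_of_le [Finite ℋ.graph.Vertex] [Finite ℋ.graph.Edge] (hℋ : ℋ.Thm37Hypotheses)
    (c : TemperedPiChart ℋ) {S M V K₂ : Subgroup c.G} (hM : IsMaximalCompactSubgroup M)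
    (hK₂ : IsMaximalCompactSubgroup K₂) {v : ℋ.graph.Vertex} (hV : V ∈ verticialSubgroups c v)
    (hopen : IsOpen ((Subtype.val : M → c.G) ⁻¹' (S : Set c.G))) (hSV : S ≤ V)
    (hSK : S ≤ K₂) : K₂ = V := by
  have hMV : M = V := eq_of_isOpen_of_le hℋ c hM hV hopen hSV
  subst hMV
  obtain ⟨w, hKw⟩ :=
    (isMaximalCompactSubgroup_iff_mem_verticialSubgroups_of_finiteGraph hℋ c K₂).1 hK₂
  have hS : S.relIndex M ≠ 0 := relIndex_ne_zero_of_isOpen_preimage hM.1 hopen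
  have hKM : K₂.relIndex M ≠ 0 := fun h0 => hS (Subgroup.relIndex_eq_zero_of_le_left hSK h0)
  exact (eq_of_relIndex_ne_zero_of_mem_verticialSubgroups verticialDistinct_holds hℋ c hV hKw hKM).symm

/-! ### A literally quasi-geometric homomorphism with range in one verticial subgroup is a "fold" -/

/-- **Fold homomorphisms are not compatibly quasi-geometric.**  Let `ℋ` be a finite graph of anabelioids
satisfying the hypotheses of Thm. 3.7, `c` a chart, and `φ : Π₁ → π₁^temp(ℋ)` a continuous homomorphism,
quasi-geometric in the LITERAL reading of Def. 3.8, whose range lies in a verticial subgroup `V`.  If `Π₁`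
has two distinct maximal compact subgroups `K₁ ≠ H₁` with `K₁ ⊓ H₁ ≠ 1`, then `φ` is not quasi-geometric
in the compatible reading: `φ(K₁)` and `φ(H₁)` are open in maximal compact subgroups, which must both be
`V` (Thm 3.7 (ii)), so no DISTINCT maximal compact `K₂ ⊇ φ(K₁)`, `H₂ ⊇ φ(H₁)` exist.
[cite: MochizukiSemiAnbd2006, Def 3.8 p.42] -/
theorem not_isCompatiblyQuasiGeometric_of_range_le [Finite ℋ.graph.Vertex] [Finite ℋ.graph.Edge]
    (hℋ : ℋ.Thm37Hypotheses) (c : TemperedPiChart ℋ) {G₁ : Type u} [Group G₁] [TopologicalSpace G₁]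
    (φ : G₁ →ₜ* c.G) (hφ : IsQuasiGeometric φ) {v : ℋ.graph.Vertex} {V : Subgroup c.G}
    (hV : V ∈ verticialSubgroups c v) (hrange : φ.toMonoidHom.range ≤ V) {K₁ H₁ : Subgroup G₁}
    (hK₁ : IsMaximalCompactSubgroup K₁) (hH₁ : IsMaximalCompactSubgroup H₁) (hne : K₁ ≠ H₁)
    (hint : K₁ ⊓ H₁ ≠ ⊥) : ¬ IsCompatiblyQuasiGeometric φ := by
  intro hc
  obtain ⟨K₂, H₂, hK₂, hH₂, hne₂, hK₁₂, hH₁₂⟩ := hc.compat K₁ H₁ hK₁ hH₁ hne hint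
  obtain ⟨M, hM, hKM⟩ := hφ.maximal K₁ hK₁
  obtain ⟨M', hM', hHM'⟩ := hφ.maximal H₁ hH₁
  have hKV : K₁.map φ.toMonoidHom ≤ V := (Subgroup.map_le_range _ _).trans hrange
  have hHV : H₁.map φ.toMonoidHom ≤ V := (Subgroup.map_le_range _ _).trans hrange
  have h1 : K₂ = V := eq_of_le_of_isOpen_of_le hℋ c hM hK₂ hV hKM.2 hKV hK₁₂
  have h2 : H₂ = V := eq_of_le_of_isOpen_of_le hℋ c hM' hH₂ hV hHM'.2 hHV hH₁₂
  exact hne₂ (h1.trans h2.symm)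

/-! ### The reduction: a fold witness at a finite Cor-3.9 pair refutes the literal `Cor39` -/

/-- **A fold witness refutes the literal Cor. 3.9.**  If, for some FINITE `𝒢`, `ℋ` satisfying the
hypotheses of Cor. 3.9 and some charts, a continuous homomorphism `φ : π₁^temp(𝒢) → π₁^temp(ℋ)` is
quasi-geometric in the literal reading of Def. 3.8 but not in the compatible reading, then the frozen
literal rendering `Cor39` is false: its clause (b) yields a locally open `F` with `F.Induces φ`, which is
`F.InducesWith F.chosenConjugators φ` (`Hom.induces_iff_inducesWith_chosen`), and clause (a) of the
theorem `cor39UpToTwistAt_of_finite` (Cor. 3.9 up to twist at finite graphs, in tree) makes `φ` compatibly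
quasi-geometric.  Choice-independent: no property of the chosen conjugators is used.
[cite: MochizukiSemiAnbd2006, Cor 3.9 p.42] -/
theorem not_cor39_of_fold [Finite 𝒢.graph.Vertex] [Finite 𝒢.graph.Edge] [Finite ℋ.graph.Vertex]
    [Finite ℋ.graph.Edge] (h𝒢 : Cor39Hypotheses 𝒢) (hℋ : Cor39Hypotheses ℋ) (c𝒢 : TemperedPiChart 𝒢)
    (cℋ : TemperedPiChart ℋ) (φ : c𝒢.G →ₜ* cℋ.G) (hqg : IsQuasiGeometric φ)
    (hfold : ¬ IsCompatiblyQuasiGeometric φ) : ¬ Cor39.{u} := by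
  intro h
  obtain ⟨F, hF, hind, -⟩ := (h 𝒢 ℋ h𝒢 hℋ c𝒢 cℋ).2 φ hqg
  exact hfold ((cor39UpToTwistAt_of_finite h𝒢 hℋ c𝒢 cℋ).1 F hF φ
    ⟨F.chosenConjugators, (F.induces_iff_inducesWith_chosen c𝒢 cℋ φ).1 hind⟩)

/-- **Assembled reduction.**  At a finite Cor-3.9 pair `(𝒢, ℋ)` with charts: a continuous homomorphism
`φ : π₁^temp(𝒢) → π₁^temp(ℋ)`, quasi-geometric in the literal reading, whose range lies in a verticial
subgroup of `π₁^temp(ℋ)`, refutes the literal `Cor39` as soon as `π₁^temp(𝒢)` has two distinct maximal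
compact subgroups meeting nontrivially (e.g. the two verticial hosts of a nontrivial edge-like subgroup).
[cite: MochizukiSemiAnbd2006, Cor 3.9 p.42] -/
theorem not_cor39_of_range_le [Finite 𝒢.graph.Vertex] [Finite 𝒢.graph.Edge] [Finite ℋ.graph.Vertex]
    [Finite ℋ.graph.Edge] (h𝒢 : Cor39Hypotheses 𝒢) (hℋ : Cor39Hypotheses ℋ) (c𝒢 : TemperedPiChart 𝒢)
    (cℋ : TemperedPiChart ℋ) (φ : c𝒢.G →ₜ* cℋ.G) (hqg : IsQuasiGeometric φ) {v : ℋ.graph.Vertex}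
    {V : Subgroup cℋ.G} (hV : V ∈ verticialSubgroups cℋ v) (hrange : φ.toMonoidHom.range ≤ V)
    {K₁ H₁ : Subgroup c𝒢.G} (hK₁ : IsMaximalCompactSubgroup K₁) (hH₁ : IsMaximalCompactSubgroup H₁)
    (hne : K₁ ≠ H₁) (hint : K₁ ⊓ H₁ ≠ ⊥) : ¬ Cor39.{u} :=
  not_cor39_of_fold h𝒢 hℋ c𝒢 cℋ φ hqg
    (not_isCompatiblyQuasiGeometric_of_range_le hℋ.thm37Hypotheses cℋ φ hqg hV hrange hK₁ hH₁ hne hint)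

end ProfiniteSemiGraph

end Literature.AnabelianGeometry.SemiGraphs
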